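import Summits.ResolutionOfSingularities.ResolutionOfSingularities.Theorems.WeightedInvariantContactCentreFiltrationBasic
import Literature.AlgebraicGeometry.Resolution.OriginLocalRing
import HarnessLib

/-!
# Arcs through the origin of `k[x₁,…,xₙ]_0` and the contact-level test (tools for kernel specimens of the (ι, b_max) letters)

Route `ResolutionOfSingularities/WeightedInvariant`, crux `Theses.WeightedInvariant.HypersurfaceCentreConstruction`
(stmt-ResolutionOfSingularities-19897), door line `local-engine`, KEY `stub_localWeightedDropEFT4S`, ORDER (o30) «IOTA3-DESIGN
inputs» of res-L1-w43-plan-1 (2026-08-27): kernel certificates for DESIGN NOTE «E8» (DEALS gen 10 #3 (2) / #5 (2), res-type-057).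
This file is the def-free TOOLKIT; the specimen itself is `…ContactLevelE8`.

* `ContactLevelArcs.exists_arcHom` — for an arc `γ : Fin n → k⟦t⟧` through the origin, a ring homomorphism
  `φ : k[x₁,…,xₙ]_{(x)} → k⟦t⟧` extending substitution, LOCAL (`φ(𝔪) ⊆ (t)`), with `φ(G/s) ∈ (t)^c` whenever `G ∘ γ ∈ (t)^c`
  (`IsLocalization.lift`; denominators have non-zero constant term, hence are units of `k⟦t⟧`);
* fractions and linear parts: every `G ∈ 𝔪₀ = (x₁,…,xₙ)` is `Σ Xᵢ Qᵢ`; if all `Qᵢ(0) = 0` then `G ∈ 𝔪₀²`; along a LINEAR arc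
  `γᵢ = cᵢ t`, `(Σ Xᵢ Qᵢ) ∘ γ = t · Σ cᵢ (Qᵢ ∘ γ)`, so `Σ cᵢ Qᵢ(0) = 0 ⇒ G ∘ γ ∈ (t)²` (`aeval_linearArc_mem_sq`);
* the TEST (`map_mem_pow_of_mem_contactFiltration`): for a homomorphism of local rings `φ : S → T` with `φ(𝔪_S) ⊆ 𝔪_T`, if `f`
  lies in degree `m` of the contact filtration `⨆ⱼ (gʲ)·𝔪^{m − bj}` (res-type-092's `contactFiltration`, p514802) and `φ g ∈ 𝔪_T^c`,
  then `φ f ∈ 𝔪_T^N` for every `N ≤ min_j (c j + (m − b j))` — so a reached contact level is REFUTED by one arc along which `g`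
  vanishes to order `c` but `f` does not vanish to order `N`.

Def-free helper (`--supports stmt-ResolutionOfSingularities-19897`); OURS bookkeeping for the design of the door's KEY; nothing here
is a claim about resolution of singularities in positive characteristic.  AI-written; weaker than expert review.
[cite: ZariskiSamuel1960, Ch. VIII §1]
-/

noncomputable section

set_option linter.dupNamespace false -- mandated namespace of this single-conjunct summit

open IsLocalRing MvPolynomial
open Literature.AlgebraicGeometry.Resolution
open Summit.ResolutionOfSingularities.ResolutionOfSingularities.Theorems

namespace Summit.ResolutionOfSingularities.ResolutionOfSingularities.Cruxes.HypersurfaceCentreConstruction.LocalEngine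

namespace ContactLevelArcs

variable (k : Type) [Field k] {n : ℕ}

/-! ## Arcs through the origin and the arc homomorphism `k[x]_0 → k⟦t⟧` -/

/-- Along an arc through the origin (`γᵢ(0) = 0`), the constant coefficient of `p ∘ γ` is `p(0)`. [folklore] -/
theorem constantCoeff_aeval_arc (γ : Fin n → PowerSeries k) (hγ : ∀ i, PowerSeries.constantCoeff (γ i) = 0)
    (p : MvPolynomial (Fin n) k) :
    PowerSeries.constantCoeff (MvPolynomial.aeval γ p) = MvPolynomial.constantCoeff p := by
  have h : (PowerSeries.constantCoeff (R := k)).comp (MvPolynomial.aeval γ).toRingHom =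
      (MvPolynomial.constantCoeff : MvPolynomial (Fin n) k →+* k) := by
    refine MvPolynomial.ringHom_ext (fun a => ?_) (fun i => ?_)
    · simp
    · simp [hγ i]
  exact congrArg (fun φ : MvPolynomial (Fin n) k →+* k => φ p) h

/-- `(t)^c` in `k⟦t⟧`: membership is the vanishing of the coefficients below `c`. [folklore] -/
theorem mem_maximalIdeal_pow_iff (c : ℕ) (φ : PowerSeries k) :
    φ ∈ maximalIdeal (PowerSeries k) ^ c ↔ ∀ m < c, PowerSeries.coeff m φ = 0 := by
  rw [PowerSeries.maximalIdeal_eq_span_X, Ideal.span_singleton_pow, Ideal.mem_span_singleton, PowerSeries.X_pow_dvd_iff]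

/-- `X^c · ψ ∈ (t)^c`. [folklore] -/
theorem X_pow_mul_mem_maximalIdeal_pow (c : ℕ) (ψ : PowerSeries k) :
    PowerSeries.X ^ c * ψ ∈ maximalIdeal (PowerSeries k) ^ c := by
  rw [PowerSeries.maximalIdeal_eq_span_X, Ideal.span_singleton_pow]
  exact Ideal.mul_mem_right _ _ (Ideal.mem_span_singleton_self _)

/-- `X^c · ψ ∈ (t)^{c+1}` when `ψ(0) = 0`. [folklore] -/
theorem X_pow_mul_mem_maximalIdeal_pow_succ (c : ℕ) {ψ : PowerSeries k} (hψ : PowerSeries.constantCoeff ψ = 0) :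
    PowerSeries.X ^ c * ψ ∈ maximalIdeal (PowerSeries k) ^ (c + 1) := by
  obtain ⟨ψ', rfl⟩ := PowerSeries.X_dvd_iff.mpr hψ
  rw [← mul_assoc, ← pow_succ]
  exact X_pow_mul_mem_maximalIdeal_pow k (c + 1) ψ'

/-- `X · ψ ∈ (t)²` when `ψ(0) = 0`. [folklore] -/
theorem X_mul_mem_maximalIdeal_sq {ψ : PowerSeries k} (hψ : PowerSeries.constantCoeff ψ = 0) :
    PowerSeries.X * ψ ∈ maximalIdeal (PowerSeries k) ^ 2 := by
  have h := X_pow_mul_mem_maximalIdeal_pow_succ k 1 hψ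
  rwa [pow_one] at h

/-- **The arc homomorphism** (def-free packaging): for an arc `γ` through the origin there is a ring homomorphism
`φ : k[x₁,…,xₙ]_0 → k⟦t⟧` extending the substitution `p ↦ p ∘ γ`, LOCAL (`φ(𝔪) ⊆ (t)`), and sending a fraction `G/s` into
`(t)^c` as soon as `G ∘ γ ∈ (t)^c`. [folklore] -/
theorem exists_arcHom (γ : Fin n → PowerSeries k) (hγ : ∀ i, PowerSeries.constantCoeff (γ i) = 0) :
    ∃ φ : OriginLocalization k n →+* PowerSeries k,
      (∀ p : MvPolynomial (Fin n) k,
        φ (algebraMap (MvPolynomial (Fin n) k) (OriginLocalization k n) p) = MvPolynomial.aeval γ p) ∧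
      (maximalIdeal (OriginLocalization k n)).map φ ≤ maximalIdeal (PowerSeries k) ∧
      (∀ (G : MvPolynomial (Fin n) k) (s : (originIdeal k n).primeCompl) (c : ℕ),
        MvPolynomial.aeval γ G ∈ maximalIdeal (PowerSeries k) ^ c →
        φ (IsLocalization.mk' (OriginLocalization k n) G s) ∈ maximalIdeal (PowerSeries k) ^ c) := by
  have hunit : ∀ s : (originIdeal k n).primeCompl, IsUnit ((MvPolynomial.aeval γ).toRingHom (s : MvPolynomial (Fin n) k)) := by
    rintro ⟨s, hs⟩
    rw [PowerSeries.isUnit_iff_constantCoeff]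
    change IsUnit (PowerSeries.constantCoeff (MvPolynomial.aeval γ s))
    rw [constantCoeff_aeval_arc k γ hγ s]
    exact Ne.isUnit hs
  let φ : OriginLocalization k n →+* PowerSeries k := IsLocalization.lift (M := (originIdeal k n).primeCompl) hunit
  have hφ : ∀ p : MvPolynomial (Fin n) k,
      φ (algebraMap (MvPolynomial (Fin n) k) (OriginLocalization k n) p) = MvPolynomial.aeval γ p :=
    fun p => IsLocalization.lift_eq hunit p
  refine ⟨φ, hφ, ?_, fun G s c hG => ?_⟩
  · rw [← Localization.AtPrime.map_eq_maximalIdeal, Ideal.map_map, Ideal.map_le_iff_le_comap]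
    intro p hp
    rw [Ideal.mem_comap, RingHom.comp_apply, hφ, ← PowerSeries.ker_coeff_eq_max_ideal, RingHom.mem_ker,
      constantCoeff_aeval_arc k γ hγ p]
    exact hp
  · have hu : IsUnit (MvPolynomial.aeval γ (s : MvPolynomial (Fin n) k)) := hunit s
    have h : φ (IsLocalization.mk' (OriginLocalization k n) G s) * MvPolynomial.aeval γ (s : MvPolynomial (Fin n) k) =
        MvPolynomial.aeval γ G := by
      rw [← hφ (s : MvPolynomial (Fin n) k), ← map_mul, IsLocalization.mk'_spec, hφ]
    rw [← Ideal.unit_mul_mem_iff_mem _ hu, mul_comm, h]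
    exact hG

/-! ## Fractions and linear parts -/

/-- An element of the origin ideal is `Σᵢ Xᵢ · Qᵢ`. [folklore] -/
theorem exists_eq_sum_X_mul_of_mem_originIdeal {G : MvPolynomial (Fin n) k} (hG : G ∈ originIdeal k n) :
    ∃ Q : Fin n → MvPolynomial (Fin n) k, G = ∑ i, MvPolynomial.X i * Q i := by
  rw [originIdeal_eq_span, Ideal.mem_span_range_iff_exists_fun] at hG
  obtain ⟨Q, hQ⟩ := hG
  exact ⟨Q, by rw [← hQ]; exact Finset.sum_congr rfl fun i _ => mul_comm _ _⟩

/-- If all the `Qᵢ` vanish at the origin, `Σᵢ Xᵢ Qᵢ ∈ 𝔪₀²`. [folklore] -/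
theorem sum_X_mul_mem_sq (Q : Fin n → MvPolynomial (Fin n) k) (hQ : ∀ i, MvPolynomial.constantCoeff (Q i) = 0) :
    (∑ i, MvPolynomial.X i * Q i) ∈ originIdeal k n ^ 2 := by
  refine Ideal.sum_mem _ fun i _ => ?_
  rw [pow_two]
  exact Ideal.mul_mem_mul (by simp) (by simpa [mem_originIdeal_iff] using hQ i)

/-- A fraction `G/s` with `G ∈ 𝔪₀^c` lies in `𝔪^c`. [folklore] -/
theorem mk'_mem_maximalIdeal_pow {G : MvPolynomial (Fin n) k} {c : ℕ} (hG : G ∈ originIdeal k n ^ c)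
    (s : (originIdeal k n).primeCompl) :
    IsLocalization.mk' (OriginLocalization k n) G s ∈ maximalIdeal (OriginLocalization k n) ^ c := by
  rw [IsLocalization.mk'_eq_mul_mk'_one, ← Localization.AtPrime.map_eq_maximalIdeal, ← Ideal.map_pow]
  exact Ideal.mul_mem_right _ _ (Ideal.mem_map_of_mem _ hG)

/-- **Linear arcs.**  Along `γᵢ = cᵢ t`: `(Σᵢ Xᵢ Qᵢ) ∘ γ = t · Σᵢ cᵢ (Qᵢ ∘ γ)`. [folklore] -/
theorem aeval_linearArc_sum_X_mul (c : Fin n → k) (Q : Fin n → MvPolynomial (Fin n) k) :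
    MvPolynomial.aeval (fun i => PowerSeries.C (c i) * PowerSeries.X) (∑ i, MvPolynomial.X i * Q i) =
      PowerSeries.X * ∑ i, PowerSeries.C (c i) *
        MvPolynomial.aeval (fun i => PowerSeries.C (c i) * PowerSeries.X) (Q i) := by
  rw [map_sum, Finset.mul_sum]
  refine Finset.sum_congr rfl fun i _ => ?_
  rw [map_mul, MvPolynomial.aeval_X]
  ring

/-- The arc `γᵢ = cᵢ t` passes through the origin. [folklore] -/
theorem constantCoeff_linearArc (c : Fin n → k) (i : Fin n) :
    PowerSeries.constantCoeff (PowerSeries.C (c i) * PowerSeries.X : PowerSeries k) = 0 := by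
  simp

/-- **First-order test**: if `Σᵢ cᵢ Qᵢ(0) = 0` then `(Σᵢ Xᵢ Qᵢ) ∘ γ ∈ (t)²` along the linear arc `γᵢ = cᵢ t`
(the linear part of `G = Σ Xᵢ Qᵢ` is `Σ Qᵢ(0) Xᵢ`, killed to first order by the arc). [folklore] -/
theorem aeval_linearArc_mem_sq (c : Fin n → k) (Q : Fin n → MvPolynomial (Fin n) k)
    (h : ∑ i, c i * MvPolynomial.constantCoeff (Q i) = 0) :
    MvPolynomial.aeval (fun i => PowerSeries.C (c i) * PowerSeries.X) (∑ i, MvPolynomial.X i * Q i) ∈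
      maximalIdeal (PowerSeries k) ^ 2 := by
  rw [aeval_linearArc_sum_X_mul]
  refine X_mul_mem_maximalIdeal_sq k ?_
  rw [map_sum]
  simp only [map_mul, PowerSeries.constantCoeff_C, constantCoeff_aeval_arc k _ (constantCoeff_linearArc k c)]
  exact h

end ContactLevelArcs

/-! ## The contact-level test along a local homomorphism -/

section Test

variable {S T : Type} [CommRing S] [CommRing T] [IsLocalRing S] [IsLocalRing T]

/-- If `h ∈ 𝔪^c`, the contact filtration of `h` with weight `b` in degree `m` lies in `𝔪^N` for every `N` below all the
piece exponents `c j + (m - b j)`. [folklore] -/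
theorem contactFiltration_le_pow_of_mem_pow {h : T} {c b m N : ℕ} (hh : h ∈ maximalIdeal T ^ c)
    (hN : ∀ j : ℕ, N ≤ c * j + (m - b * j)) : contactFiltration h b m ≤ maximalIdeal T ^ N := by
  rw [contactFiltration_def]
  refine iSup_le fun j => ?_
  calc Ideal.span {h ^ j} * maximalIdeal T ^ (m - b * j)
      ≤ maximalIdeal T ^ (c * j) * maximalIdeal T ^ (m - b * j) := by
        refine Ideal.mul_mono_left ?_
        rw [Ideal.span_singleton_le_iff_mem, pow_mul]
        exact Ideal.pow_mem_pow hh j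
    _ = maximalIdeal T ^ (c * j + (m - b * j)) := (pow_add _ _ _).symm
    _ ≤ maximalIdeal T ^ N := Ideal.pow_le_pow_right (hN j)

/-- **Test for reached contact levels along a local homomorphism.**  Let `φ : S → T` be a homomorphism of local rings
with `φ(𝔪_S) ⊆ 𝔪_T`.  If `f` lies in degree `m` of the contact filtration of `g` with weight `b`, `φ g ∈ 𝔪_T^c`, and
`N ≤ c j + (m - b j)` for every `j`, then `φ f ∈ 𝔪_T^N`. [folklore] -/
theorem map_mem_pow_of_mem_contactFiltration (φ : S →+* T) (hφ : (maximalIdeal S).map φ ≤ maximalIdeal T)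
    {f g : S} {b m c N : ℕ} (hf : f ∈ contactFiltration g b m) (hg : φ g ∈ maximalIdeal T ^ c)
    (hN : ∀ j : ℕ, N ≤ c * j + (m - b * j)) : φ f ∈ maximalIdeal T ^ N :=
  contactFiltration_le_pow_of_mem_pow hg hN
    (map_contactFiltration_le_of_map_maximalIdeal_le φ hφ g b m (Ideal.mem_map_of_mem φ hf))

/-- Transport of `𝔪^c` along a local homomorphism. [folklore] -/
theorem map_mem_pow_of_mem_pow (φ : S →+* T) (hφ : (maximalIdeal S).map φ ≤ maximalIdeal T) {f : S} {c : ℕ}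
    (hf : f ∈ maximalIdeal S ^ c) : φ f ∈ maximalIdeal T ^ c := by
  have h := Ideal.mem_map_of_mem φ hf
  rw [Ideal.map_pow] at h
  exact Ideal.pow_right_mono hφ c h

end Test


end Summit.ResolutionOfSingularities.ResolutionOfSingularities.Cruxes.HypersurfaceCentreConstruction.LocalEngine

end
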